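import Summits.BirchSwinnertonDyer.BirchSwinnertonDyer.Theorems.ManinLocalTwoThreeDegeneracyUnitTwistSignMove
import HarnessLib

/-!
# THEOREM U (es g22, MEMO-es §36.11), part 2/3: the f-level core — a tame even character NON-TRIVIAL ON `⟨t̄⟩` with a `3`-adic
# unit twisted value from the ratio-`t` DEGENERACY plus index (t = 9: the POLAR clause `χ(3) ∉ {±1}`; t = 3: `χ(3) ≠ 1`)

Summit `BirchSwinnertonDyer`, route `ManinLocalTwoThree` (cell bsd-f2-manin), crux C3 `ManinPrimeToThreeAtNine`
(stmt-BirchSwinnertonDyer-22968).  es's THEOREM U (paper, MEMO-es §36.11 (3); typer ask T-es-29 (e)/(f)) over TREE declarations: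

* §3 `exists_mem_plus_not_three_dvd` (closure induction: a generator with plus part `≢ 0 (mod 3Ω⁺)`) and the **f-level core**
  `exists_prime_character_unit_twist_of_degeneracyPlusIndex`: `f` a rational newform on `Γ₀(N)`, `3 ∣ N`, `t ≥ 1`, and every
  `x ∈ Λ_f` has a prime-to-`3` multiple of `x + x̄` among the plus parts of `closure (degeneracyLoops f t)` (es's
  `DegeneracyPlusIndexPrimeTo 3 t f`, written inline) ⟹ a prime `m ∤ tN`, `m ≡ 2 (mod 3)`, an EVEN character `χ` mod `m` with
  `χ(t) ≠ 1`, and `S_χ = r·Ω⁺_f` with `s·r/3` never an algebraic integer (`3 ∤ s`).  Proof: the sign move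
  (`exists_degeneracyLoop_prime_mod_three_eq_two`) makes `m ≡ 2 (mod 3)`; `F(a) = ({∞,a/m} − {∞,0} + conj)/Ω⁺ ∈ ℤ` is even with
  `3 ∤ F(t̄b̄) − F(b̄)`; the RELATIVE span lemma `Int.dvd_sub_of_forall_isIntegral_charSum_div_of_apply_ne_one` (Φ_H, `H = ⟨t̄⟩`)
  yields `χ` with `χ(t̄) ≠ 1`; evenness and `r = F̂(χ)/2` as in E-es-87♭.
* §4 `tamePolarUnitTwistOfDegeneracyNinePlusIndex` (t = 9: `χ(9) ≠ 1 ⟹ χ(3) ∉ {1, −1}`, the POLAR clause of F-es-18; primitive,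
  order prime to `3`, `(m, 3N) = 1`) = es's E-es-90 at the f-level, and `tameKPUnitTwistOfDegeneracyThreePlusIndex` (t = 3:
  `χ(3) ≠ 1`, the Kosters–Pannekoek clause for `ā ∈ {0, +1}`) = es's E-es-89 at the f-level.

HONEST FRAMING: unconditional f-level theorems about period lattices of rational newforms; the W-level consequences (E-es-66 on
the squarefull locus ⟸ E-es-68₉; `3 ∤ c` modulo Kato's fact) are in part 3/3.  C3, Manin's conjecture and BSD are NOT proved.
No definitions, no named facts, no sorry.
-/

set_option linter.dupNamespace false
set_option autoImplicit false

noncomputable section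

open scoped Classical MatrixGroups ModularForm ComplexConjugate

open CongruenceSubgroup Complex Literature.NumberTheory.EllipticCurves
  Literature.NumberTheory.EllipticCurves.ModularForms
  Summit.BirchSwinnertonDyer.Rank1Residual.ManinAdditive.Gamma1Lattice
  Summit.BirchSwinnertonDyer.Rank1Residual.ManinAdditive.KatoCurve

namespace Summit.BirchSwinnertonDyer.BirchSwinnertonDyer.Theorems.ManinLocalTwoThree

variable {N : ℕ} [NeZero N] {f : CuspForm (Gamma0 N) 2}

/-! ### §3 The f-level THEOREM U core: a character non-trivial on `⟨t̄⟩` with a unit twisted value -/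

/-- For any set `S ⊆ Λ_f` whose closure carries a prime-to-`3` multiple of every plus period, some `z ∈ S` has plus part
`z + z̄ = j·Ω⁺_f` with `3 ∤ j` (closure induction; `re Λ_f = ℤ·Ω⁺_f/2`). -/
theorem exists_mem_plus_not_three_dvd (hf : IsNewform0 f) (hQ : coeffField f = ⊥) {S : Set ℂ}
    (hS : S ⊆ periodLattice f)
    (hd : ∀ x ∈ periodLattice f, ∃ y ∈ AddSubgroup.closure S, ∃ k : ℕ, ¬ 3 ∣ k ∧
      (k : ℂ) * (x + conj x) = y + conj y) :
    ∃ z ∈ S, ∃ j : ℤ, z + conj z = (j : ℂ) * (plusPeriod f : ℂ) ∧ ¬ (3 : ℤ) ∣ j := by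
  obtain ⟨hpos, -⟩ := plusPeriod_pos_and_realPeriods_eq isZLattice_periodLattice_holds hf hQ
  have hΩ : (plusPeriod f : ℂ) ≠ 0 := by exact_mod_cast hpos.ne'
  by_contra hcon
  push Not at hcon
  have hall : ∀ y ∈ AddSubgroup.closure S, ∃ j : ℤ, y + conj y = (j : ℂ) * (plusPeriod f : ℂ) ∧ (3 : ℤ) ∣ j := by
    intro y hy
    induction hy using AddSubgroup.closure_induction with
    | mem z hz =>
      obtain ⟨j, hj⟩ := exists_int_add_conj_eq_mul_plusPeriod hf hQ (hS hz)
      exact ⟨j, hj, hcon z hz j hj⟩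
    | zero => exact ⟨0, by simp, dvd_zero _⟩
    | add x y _ _ hx hy =>
      obtain ⟨j₁, hj₁, h₁⟩ := hx
      obtain ⟨j₂, hj₂, h₂⟩ := hy
      refine ⟨j₁ + j₂, ?_, dvd_add h₁ h₂⟩
      rw [map_add, Int.cast_add, add_mul, ← hj₁, ← hj₂]; ring
    | neg x _ hx =>
      obtain ⟨j, hj, h⟩ := hx
      refine ⟨-j, ?_, (dvd_neg).mpr h⟩
      rw [map_neg, Int.cast_neg, neg_mul, ← hj]; ring
  obtain ⟨x₀, hx₀, hx₀Ω⟩ := exists_mem_periodLattice_add_conj_eq_plusPeriod hf hQ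
  obtain ⟨y, hy, k, hk3, hk⟩ := hd x₀ hx₀
  obtain ⟨j, hj, hj3⟩ := hall y hy
  rw [hx₀Ω, hj] at hk
  have hkj : (k : ℤ) = j := by
    have h1 : ((k : ℤ) : ℂ) = (j : ℂ) := by
      have := mul_right_cancel₀ hΩ hk
      exact_mod_cast this
    exact_mod_cast h1
  exact hk3 (Int.natCast_dvd_natCast.mp (hkj ▸ hj3))

/-- **THEOREM U, f-level core.**  Let `f` be a rational newform on `Γ₀(N)`, `3 ∣ N`, `t ≥ 1`, and suppose every `x ∈ Λ_f`
has a prime-to-`3` multiple of `x + x̄` among the plus parts of `closure (degeneracyLoops f t)` (es's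
`DegeneracyPlusIndexPrimeTo 3 t f`).  Then there are a prime `m ∤ tN` with `m ≡ 2 (mod 3)`, an EVEN Dirichlet character
`χ` mod `m` with `χ(t) ≠ 1`, and `r` with `S_χ = r·Ω⁺_f` and `s·r/3` not an algebraic integer for every `3 ∤ s`. -/
theorem exists_prime_character_unit_twist_of_degeneracyPlusIndex (hf : IsNewform0 f) (hQ : coeffField f = ⊥)
    (h3 : 3 ∣ N) {t : ℕ} (ht : 0 < t)
    (hd : ∀ x ∈ periodLattice f, ∃ y ∈ AddSubgroup.closure (degeneracyLoops f t), ∃ k : ℕ, ¬ 3 ∣ k ∧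
      (k : ℂ) * (x + conj x) = y + conj y) :
    ∃ (m : ℕ) (_ : Fact m.Prime) (χ : DirichletCharacter ℂ m) (r : ℂ), ¬ m ∣ t * N ∧ m % 3 = 2 ∧
      χ (t : ZMod m) ≠ 1 ∧ χ.Even ∧ twistedSymbolSum f χ = r * (plusPeriod f : ℂ) ∧
      ∀ s : ℕ, ¬ 3 ∣ s → ¬ IsIntegral ℤ ((s : ℂ) * r / 3) := by
  obtain ⟨hpos, -⟩ := plusPeriod_pos_and_realPeriods_eq isZLattice_periodLattice_holds hf hQ
  have hΩ : (plusPeriod f : ℂ) ≠ 0 := by exact_mod_cast hpos.ne'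
  have hreal : ∀ n, (cuspCoeff f n).im = 0 := cuspCoeff_im_eq_zero_of_coeffField_eq_bot hQ
  -- a loop with plus part not in `3ℤΩ⁺`
  have hS : degeneracyLoops f t ⊆ periodLattice f := fun z hz ↦
    periodLatticeGamma1_le_periodLattice f (closure_degeneracyLoops_le f t (AddSubgroup.subset_closure hz))
  obtain ⟨z, ⟨ℓ, b, hℓp, hℓt, hℓb, rfl⟩, j, hj, hj3⟩ := exists_mem_plus_not_three_dvd hf hQ hS hd
  -- the sign move: `m ≡ 2 (mod 3)`
  obtain ⟨m, hmp, hmt, hmb, hm3, hplus⟩ := exists_degeneracyLoop_prime_mod_three_eq_two f hreal h3 ht hℓp hℓt hℓb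
  rw [← hplus] at hj
  haveI : Fact m.Prime := ⟨hmp⟩
  have hmN : ¬ m ∣ N := fun h ↦ hmt (h.mul_left t)
  have hmt' : ¬ m ∣ t := fun h ↦ hmt (h.mul_right N)
  have hNm : IsCoprime (N : ℤ) m :=
    (Nat.isCoprime_iff_coprime.mpr ((Nat.Prime.coprime_iff_not_dvd hmp).mpr hmN)).symm
  -- the integer-valued even function `F`
  have hF : ∀ a : ZMod m, ∃ k : ℤ, (modularSymbol f ((a.val : ℚ) / m) - modularSymbol f 0) +
      conj (modularSymbol f ((a.val : ℚ) / m) - modularSymbol f 0) = (k : ℂ) * (plusPeriod f : ℂ) :=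
    fun a ↦ exists_int_add_conj_eq_mul_plusPeriod hf hQ (cuspDiff_mem_periodLattice f hNm a)
  choose F hF using hF
  have hFeven : ∀ a : ZMod m, F (-a) = F a := by
    intro a
    have h1 := hF (-a)
    rw [cuspDiff_neg_val_eq_conj f hreal, Complex.conj_conj, add_comm, hF a] at h1
    exact_mod_cast (mul_right_cancel₀ hΩ h1).symm
  -- `F (t̄ b̄) − F b̄ = j`, not divisible by `3`
  have htb : ((t * b : ℕ) : ZMod m) = (t : ZMod m) * (b : ZMod m) := by push_cast; rfl
  have hzF : (j : ℂ) * (plusPeriod f : ℂ) =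
      ((F ((t : ZMod m) * (b : ZMod m)) - F (b : ZMod m) : ℤ) : ℂ) * (plusPeriod f : ℂ) := by
    rw [← hj, modularSymbol_natCast_div_eq_val f (t * b), modularSymbol_natCast_div_eq_val f b, htb]
    have e : modularSymbol f (((((t : ZMod m) * (b : ZMod m))).val : ℚ) / m) -
        modularSymbol f ((((b : ZMod m)).val : ℚ) / m) =
        (modularSymbol f (((((t : ZMod m) * (b : ZMod m))).val : ℚ) / m) - modularSymbol f 0) -
          (modularSymbol f ((((b : ZMod m)).val : ℚ) / m) - modularSymbol f 0) := by ring
    rw [e, map_sub, Int.cast_sub, sub_mul, ← hF, ← hF]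
    ring
  have hjF : j = F ((t : ZMod m) * (b : ZMod m)) - F (b : ZMod m) := by
    have := mul_right_cancel₀ hΩ hzF
    exact_mod_cast this
  have hunit_t : IsUnit ((t : ℕ) : ZMod m) :=
    (ZMod.isUnit_iff_coprime t m).mpr ((Nat.Prime.coprime_iff_not_dvd hmp).mpr hmt').symm
  have hunit_b : IsUnit ((b : ℕ) : ZMod m) :=
    (ZMod.isUnit_iff_coprime b m).mpr ((Nat.Prime.coprime_iff_not_dvd hmp).mpr hmb).symm
  -- `3 ∤ φ(m) = m − 1`
  have hφ : ¬ 3 ∣ m.totient := by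
    rw [Nat.totient_prime hmp]
    have := hmp.one_le
    omega
  -- the RELATIVE span lemma, contrapositively
  have hex : ∃ χ : DirichletCharacter ℂ m, χ (t : ZMod m) ≠ 1 ∧
      ∀ s : ℕ, ¬ 3 ∣ s → ¬ IsIntegral ℤ ((s : ℂ) * (∑ a : ZMod m, χ a * (F a : ℂ)) / (3 : ℕ)) := by
    by_contra hcon
    push Not at hcon
    have := Int.dvd_sub_of_forall_isIntegral_charSum_div_of_apply_ne_one Nat.prime_three hφ F hunit_t
      (fun χ hχ ↦ hcon χ hχ) hunit_b
    exact hj3 (hjF ▸ (by exact_mod_cast this))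
  obtain ⟨χ, hχt, hχ⟩ := hex
  -- `χ` is even
  have hev : χ.Even := by
    rcases χ.even_or_odd with h | h
    · exact h
    · exfalso
      have hzero : ∑ a : ZMod m, χ a * (F a : ℂ) = 0 := by
        have hneg : ∑ a : ZMod m, χ a * (F a : ℂ) = -∑ a : ZMod m, χ a * (F a : ℂ) := by
          rw [← Finset.sum_neg_distrib]
          refine Fintype.sum_equiv (Equiv.neg (ZMod m)) _ _ fun a ↦ ?_
          rw [Equiv.neg_apply, h.eval_neg, hFeven]; ring
        have := add_eq_zero_iff_eq_neg.mpr hneg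
        rw [← two_mul] at this
        exact (mul_eq_zero.mp this).resolve_left two_ne_zero
      refine hχ 1 (by norm_num) ?_
      rw [hzero, mul_zero, zero_div]
      exact isIntegral_zero
  have hχ1 : χ ≠ 1 := by
    rintro rfl
    exact hχt (MulChar.one_apply hunit_t)
  -- half-sum identity, `r = F̂(χ)/2`
  refine ⟨m, ⟨hmp⟩, χ, (∑ a : ZMod m, χ a * (F a : ℂ)) / 2, hmt, hm3, hχt, hev, ?_, ?_⟩
  · have h2 := two_mul_twistedSymbolSum_eq_sum_plus f hreal hχ1 hev
    simp_rw [hF, ← mul_assoc, ← Finset.sum_mul] at h2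
    have : twistedSymbolSum f χ = (∑ a : ZMod m, χ a * (F a : ℂ)) * (plusPeriod f : ℂ) / 2 := by
      rw [← h2]; ring
    rw [this]; ring
  · intro s hs hI
    refine hχ s hs ?_
    have e : ((s : ℂ) * (∑ a : ZMod m, χ a * (F a : ℂ)) / (3 : ℕ)) =
        ((2 : ℤ) : ℂ) * ((s : ℂ) * ((∑ a : ZMod m, χ a * (F a : ℂ)) / 2) / 3) := by push_cast; ring
    rw [e]
    exact IsIntegral.mul (by simpa using isIntegral_algebraMap (R := ℤ) (A := ℂ) (x := (2 : ℤ))) hI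

/-! ### §4 The packaged f-level laws: t = 9 (POLAR clause) and t = 3 (KP clause for `ā ≠ −1`) -/

/-- **E-es-90, f-level (THEOREM U (b))**: `3 ∣ N`, rational newform `f`, ratio-`9` degeneracy plus index prime to `3` ⟹
a tame even primitive `χ ≠ 1` of prime conductor `m` prime to `3N`, order prime to `3`, with the POLAR clause
`χ(3) ∉ {1, −1}` and `S_χ = r·Ω⁺_f`, `s·r/3` never an algebraic integer (`3 ∤ s`). -/
theorem tamePolarUnitTwistOfDegeneracyNinePlusIndex (hf : IsNewform0 f) (hQ : coeffField f = ⊥) (h3 : 3 ∣ N)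
    (hd : ∀ x ∈ periodLattice f, ∃ y ∈ AddSubgroup.closure (degeneracyLoops f 9), ∃ k : ℕ, ¬ 3 ∣ k ∧
      (k : ℂ) * (x + conj x) = y + conj y) :
    ∃ (m : ℕ) (_ : NeZero m) (χ : DirichletCharacter ℂ m) (r : ℂ),
      m.Coprime (3 * N) ∧ χ.IsPrimitive ∧ χ ≠ 1 ∧ ¬ 3 ∣ orderOf χ ∧
      χ (3 : ZMod m) ≠ 1 ∧ χ (3 : ZMod m) ≠ -1 ∧ χ.Even ∧
      twistedSymbolSum f χ = r * (plusPeriod f : ℂ) ∧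
      ∀ s : ℕ, ¬ 3 ∣ s → ¬ IsIntegral ℤ ((s : ℂ) * r / 3) := by
  obtain ⟨m, hm, χ, r, hmt, hm3, hχt, hev, hr, hu⟩ :=
    exists_prime_character_unit_twist_of_degeneracyPlusIndex hf hQ h3 (t := 9) (by norm_num) hd
  have hmp : m.Prime := hm.out
  haveI : NeZero m := ⟨hmp.ne_zero⟩
  have hχ1 : χ ≠ 1 := by
    rintro rfl
    exact hχt (MulChar.one_apply ((ZMod.isUnit_iff_coprime 9 m).mpr
      ((Nat.Prime.coprime_iff_not_dvd hmp).mpr fun h ↦ hmt (h.mul_right N)).symm))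
  have h9 : ((9 : ℕ) : ZMod m) = (3 : ZMod m) * 3 := by norm_num
  have h3a : χ (3 : ZMod m) ≠ 1 := by
    intro h; apply hχt; rw [h9, map_mul, h, mul_one]
  have h3b : χ (3 : ZMod m) ≠ -1 := by
    intro h; apply hχt; rw [h9, map_mul, h]; norm_num
  have hφ : ¬ 3 ∣ m.totient := by
    rw [Nat.totient_prime hmp]
    have := hmp.one_le
    omega
  refine ⟨m, inferInstance, χ, r, ?_, DirichletCharacter.isPrimitive_of_prime hχ1, hχ1,
    fun h ↦ hφ (dvd_trans h (DirichletCharacter.orderOf_dvd_totient χ)), h3a, h3b, hev, hr, hu⟩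
  refine (Nat.Prime.coprime_iff_not_dvd hmp).mpr fun h ↦ hmt ?_
  exact dvd_trans h (mul_dvd_mul_right (by norm_num) N)

/-- **E-es-89, f-level (THEOREM U (a))**: the same with the ratio-`3` degeneracy plus index and the clause `χ(3) ≠ 1` only
(the Kosters–Pannekoek clause for `ā ∈ {0, +1}`). -/
theorem tameKPUnitTwistOfDegeneracyThreePlusIndex (hf : IsNewform0 f) (hQ : coeffField f = ⊥) (h3 : 3 ∣ N)
    (hd : ∀ x ∈ periodLattice f, ∃ y ∈ AddSubgroup.closure (degeneracyLoops f 3), ∃ k : ℕ, ¬ 3 ∣ k ∧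
      (k : ℂ) * (x + conj x) = y + conj y) :
    ∃ (m : ℕ) (_ : NeZero m) (χ : DirichletCharacter ℂ m) (r : ℂ),
      m.Coprime (3 * N) ∧ χ.IsPrimitive ∧ χ ≠ 1 ∧ ¬ 3 ∣ orderOf χ ∧ χ (3 : ZMod m) ≠ 1 ∧ χ.Even ∧
      twistedSymbolSum f χ = r * (plusPeriod f : ℂ) ∧
      ∀ s : ℕ, ¬ 3 ∣ s → ¬ IsIntegral ℤ ((s : ℂ) * r / 3) := by
  obtain ⟨m, hm, χ, r, hmt, hm3, hχt, hev, hr, hu⟩ :=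
    exists_prime_character_unit_twist_of_degeneracyPlusIndex hf hQ h3 (t := 3) (by norm_num) hd
  have hmp : m.Prime := hm.out
  haveI : NeZero m := ⟨hmp.ne_zero⟩
  have h3a : χ (3 : ZMod m) ≠ 1 := by exact_mod_cast hχt
  have hχ1 : χ ≠ 1 := by
    rintro rfl
    exact hχt (MulChar.one_apply ((ZMod.isUnit_iff_coprime 3 m).mpr
      ((Nat.Prime.coprime_iff_not_dvd hmp).mpr fun h ↦ hmt (h.mul_right N)).symm))
  have hφ : ¬ 3 ∣ m.totient := by
    rw [Nat.totient_prime hmp]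
    have := hmp.one_le
    omega
  exact ⟨m, inferInstance, χ, r, (Nat.Prime.coprime_iff_not_dvd hmp).mpr hmt,
    DirichletCharacter.isPrimitive_of_prime hχ1, hχ1,
    fun h ↦ hφ (dvd_trans h (DirichletCharacter.orderOf_dvd_totient χ)), h3a, hev, hr, hu⟩

end Summit.BirchSwinnertonDyer.BirchSwinnertonDyer.Theorems.ManinLocalTwoThree

end
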